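import Literature.RepresentationTheory.KonnoKonno2007.RealUnitaryDualPairRelabel
import Literature.NumberTheory.Weil1964.ArchTwistedDiagonalLevi
import Literature.NumberTheory.Weil1964.ArchPlacePhaseHom
import HarnessLib

/-!
# The `V`-side embedding `ι_V : U(P,Q) → Sp(V ⊗ W)` slice by slice along `W` (kernel, group side)

Topic `RepresentationTheory/KonnoKonno2007`; namespace `Literature.RepresentationTheory.KonnoKonno2007.RealDualPair`.
Continuation of `Literature.RepresentationTheory.KonnoKonno2007.RealUnitaryDualPair` (the real unitary dual pair
`ι𝕎 : U(P,Q) × U(R,S) →* Sp(𝕎)`, `𝕎 = V ⊗_ℂ W` in the tree's block coordinates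
`DPIdx P Q R S = ((P × R) ⊕ (Q × S)) ⊕ ((P × S) ⊕ (Q × R))`, twisted realification conjugating the first summand),
of `Literature.NumberTheory.Weil1964.ArchWeilDatumTensor` (`spBlock : Sp(W₁) × Sp(W₂) →* Sp(W₁ ⊕ W₂)`),
`Literature.NumberTheory.Weil1964.ArchTwistedDiagonalLevi` (the anti-symplectic involution `c = Sp.conjW`,
`(p, q) ↦ (p, −q)`, and `Sp.conjSp T = c T c`) and `Literature.NumberTheory.Weil1964.ArchPlacePhaseHom`
(`reindexSp E : Sp(σ′) →* Sp(σ)`, relabelling of coordinates along `E : σ ≃ σ′`).  KERNEL only: explicit index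
bijections and proved identities; no record, no `sorry`, no `Prop` definition.

For the first member `g ∈ U(P,Q)` write `ι_V g := ι𝕎 (g, 1)`.  As a `U(V)`-module `V ⊗ W = ⊕_{w ∈ R ⊔ S} V ⊗ e_w`,
and `g ⊗ 1` preserves every slice; on a slice over a POSITIVE line (`r ∈ R`) the induced real symplectic structure is
that of `V` (the tree's twisted realification `UForm.toSp`: conjugate the `P`-coordinates), on a slice over a NEGATIVE
line (`s ∈ S`) it is that of `V̄` (conjugate the `Q`-coordinates instead) [MoeglinVignerasWaldspurger1987, Ch. 1 I.17;
Paul1998, §1.2; Kudla1994, §1].  In the tree's coordinates this reads: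

* §1–§2 the MASTER FORMULA for `ι_V` coordinate by coordinate (`phasePt_ιV_inl_inl`, `…_inr_inr`, `…_inr_inl`,
  `…_inl_inr`): e.g. at `(p, r)` the complex coordinate of `ι_V g (w)` is
  `conj (Σ_{p′} g_{p p′} conj z_{(p′,r)} + Σ_{q′} g_{p q′} z_{(q′,r)})`, `z = p + iq` (`phasePt`);
* §3 RELABELLING: along `eR : R ≃ R′`, `eS : S ≃ S′`, with the tree's `dpIdxCongr` / `ι𝕎_relabel`
  (`RealUnitaryDualPairRelabel`), `reindexSp (dpIdxCongr 1 1 eR eS) (ι_V^{R′,S′} g) = ι_V^{R,S} g` (`reindexSp_dpIdxCongr_ιV`);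
* §4 ADDITIVITY IN `W`: the explicit bijection `dpIdxSumEquiv : DPIdx P Q R₁ S₁ ⊕ DPIdx P Q R₂ S₂ ≃ DPIdx P Q (R₁ ⊕ R₂) (S₁ ⊕ S₂)`
  satisfies **`reindexSp dpIdxSumEquiv (ι_V^{R₁ ⊕ R₂, S₁ ⊕ S₂} g) = spBlock (ι_V^{R₁,S₁} g, ι_V^{R₂,S₂} g)`**
  (`reindexSp_dpIdxSumEquiv_ιV`) — `ι_V` is a block sum over an orthogonal splitting `W = W₁ ⊕ W₂`;
* §5 A HYPERBOLIC PAIR: for `W = ⟨e₊, e₋⟩` a pair of lines of opposite signs indexed by the same `T` (`R = S = T`)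
  and the positive-line index `DPIdx P Q T S₀`, `S₀` empty, the explicit bijection
  `dpIdxPairEquiv : DPIdx P Q T S₀ ⊕ DPIdx P Q T S₀ ≃ DPIdx P Q T T` satisfies
  **`reindexSp dpIdxPairEquiv (ι_V^{T,T} g) = spBlock (X, Sp.conjSp _ X)`**, `X = ι_V^{T,S₀} g` (`reindexSp_dpIdxPairEquiv_ιV`)
  — on `V ⊗ H ≅ V ⊕ V̄` the embedding is the TWISTED DIAGONAL `T ↦ T ⊕ cTc` of `ArchTwistedDiagonalLevi` (the
  doubling geometry);
* §6 the degenerate case `W = 0`: `ι_V^{R,S} g = 1` for `R`, `S` empty (`ιV_eq_one_of_isEmpty`).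

These identities are the group-side input of the parity statement «`Ũ(p,q)` is the `det^{(r−s)/2}`-cover; in
particular it splits iff `r ≡ s (2)`» [Paul1998, §1.2 (1.2.1); Kudla1994, §1 and Prop. 4.1] realised in
`Literature.RepresentationTheory.Paul1998.MetaplecticCocycleSectionParity`.  Everything here is PROVED; citations
record provenance only.

## References

* [MoeglinVignerasWaldspurger1987] C. Mœglin, M.-F. Vignéras, J.-L. Waldspurger, *Correspondances de Howe sur un corps
  p-adique*, LNM 1291 (1987), Ch. 1 I.17 (the pair `(U(V), U(W))` in `Sp(V ⊗ W)`), Ch. 2 II.1 (6) (orthogonal sums).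
* [Paul1998] A. Paul, *Howe correspondence for real unitary groups*, J. Funct. Anal. 159 (1998) 384–431, §1.1 (1.1.2),
  §1.2 (1.2.1) p. 389.
* [Kudla1994] S. Kudla, *Splitting metaplectic covers of dual reductive pairs*, Israel J. Math. 87 (1994) 361–401, §1,
  Prop. 4.1.
* [KonnoKonno2007] K. Konno, T. Konno, Kyushu J. Math. 61 (2007), §3.1 (3.1).
-/

set_option autoImplicit false

noncomputable section

open Matrix Complex
open scoped Kronecker ComplexConjugate
open Literature.Analysis.SegalBargmann Literature.RepresentationTheory.HeisenbergGroup
open Literature.NumberTheory.Automorphic Literature.NumberTheory.Automorphic.UnitaryGroup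
open Literature.NumberTheory.Weil1964

namespace Literature.RepresentationTheory.KonnoKonno2007

namespace RealDualPair

variable {P Q R S : Type*} [Fintype P] [DecidableEq P] [Fintype Q] [DecidableEq Q] [Fintype R] [DecidableEq R]
  [Fintype S] [DecidableEq S]

local notation "PV" σ => (σ → ℝ) × (σ → ℝ)
local notation "SpR" σ => symplecticGroup (polar (dotPairing σ))

/-! ## 1. Small conversions: `phasePt` of relabelled, block and conjugated phase vectors

(`dpEquiv` on constructors: the `@[simp]` lemmas `dpEquiv_inl_inl` … of `RealUnitaryDualPairSL2` are in scope.) -/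

section PhasePt

variable {σ σ' σ₁ σ₂ : Type*}

/-- `phasePt` of a relabelled phase vector: `z(p ∘ e, q ∘ e) = z(p, q) ∘ e`. [folklore] -/
private theorem phasePt_comp (e : σ → σ') (p q : σ' → ℝ) : phasePt (p ∘ e) (q ∘ e) = phasePt p q ∘ e := rfl

/-- `phasePt` of a block phase vector on the first block. [folklore] -/
private theorem phasePt_sumElim_inl (p₁ q₁ : σ₁ → ℝ) (p₂ q₂ : σ₂ → ℝ) (k : σ₁) :
    phasePt (Sum.elim p₁ p₂) (Sum.elim q₁ q₂) (Sum.inl k) = phasePt p₁ q₁ k := rfl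

/-- `phasePt` of a block phase vector on the second block. [folklore] -/
private theorem phasePt_sumElim_inr (p₁ q₁ : σ₁ → ℝ) (p₂ q₂ : σ₂ → ℝ) (k : σ₂) :
    phasePt (Sum.elim p₁ p₂) (Sum.elim q₁ q₂) (Sum.inr k) = phasePt p₂ q₂ k := rfl

/-- `phasePt` of the conjugated phase vector `c(p, q) = (p, −q)` is the complex conjugate: `z(p, −q) = conj z(p, q)`.
[cite: Folland1989, §4.1 (4.17)] -/
theorem phasePt_neg_snd (p q : σ → ℝ) (k : σ) : phasePt p (-q) k = star (phasePt p q k) := by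
  rw [phasePt_apply, phasePt_apply, Pi.neg_apply, Complex.ofReal_neg, Complex.star_def, map_add, map_mul,
    Complex.conj_ofReal, Complex.conj_ofReal, Complex.conj_I, neg_mul, mul_neg]

end PhasePt

/-! ## 2. The master formula for `ι_V g = ι𝕎 (g, 1)` coordinate by coordinate -/

section Master

/-- matrix of the second component of `(g, 1)`. [folklore] -/
private theorem coe_snd_one (g : UForm P Q) :
    ((((g, (1 : UForm R S)) : Ginf P Q R S).2 : GL (R ⊕ S) ℂ) : Matrix (R ⊕ S) (R ⊕ S) ℂ) = 1 := by
  rw [show ((g, (1 : UForm R S)) : Ginf P Q R S).2 = 1 from rfl, OneMemClass.coe_one, Units.val_one]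

omit [DecidableEq P] [DecidableEq Q] in
/-- **`(g ⊗ 1)` in the block frame acts slice by slice**: for `k ↔ (v, w)`,
`((g ⊗ 1) y)_k = Σ_{v′} g_{v v′} y_{(v′, w)}`. [cite: MoeglinVignerasWaldspurger1987, Ch. 1 I.17] -/
theorem reindex_kronecker_one_mulVec (G : Matrix (P ⊕ Q) (P ⊕ Q) ℂ) (y : DPIdx P Q R S → ℂ) (k : DPIdx P Q R S) :
    (Matrix.reindex (dpEquiv P Q R S) (dpEquiv P Q R S) (G ⊗ₖ (1 : Matrix (R ⊕ S) (R ⊕ S) ℂ)) *ᵥ y) k =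
      ∑ p', G ((dpEquiv P Q R S).symm k).1 (Sum.inl p') * y (dpEquiv P Q R S (Sum.inl p', ((dpEquiv P Q R S).symm k).2)) +
        ∑ q', G ((dpEquiv P Q R S).symm k).1 (Sum.inr q') *
          y (dpEquiv P Q R S (Sum.inr q', ((dpEquiv P Q R S).symm k).2)) := by
  simp only [Matrix.mulVec, dotProduct, Matrix.reindex_apply, Matrix.submatrix_apply, Matrix.kroneckerMap_apply,
    Matrix.one_apply]
  rw [← Equiv.sum_comp (dpEquiv P Q R S)]
  simp only [Equiv.symm_apply_apply, Fintype.sum_prod_type, mul_ite, mul_one, mul_zero, ite_mul, zero_mul,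
    Finset.sum_ite_eq, Finset.mem_univ, if_true, Fintype.sum_sum_type]

/-- the complex coordinates of `ι_V g (w)`: `tw ((g ⊗ 1) (tw z))`, `z = phasePt w`. [cite: KonnoKonno2007, §3.1 (3.1)] -/
theorem phasePt_ιV (g : UForm P Q) (w : PV (DPIdx P Q R S)) :
    phasePt ((ι𝕎 P Q R S (g, 1)).1 w).1 ((ι𝕎 P Q R S (g, 1)).1 w).2 =
      tw (Matrix.reindex (dpEquiv P Q R S) (dpEquiv P Q R S)
        (((g : GL (P ⊕ Q) ℂ) : Matrix (P ⊕ Q) (P ⊕ Q) ℂ) ⊗ₖ (1 : Matrix (R ⊕ S) (R ⊕ S) ℂ)) *ᵥ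
          tw (phasePt w.1 w.2)) := by
  rw [phasePt_ι𝕎, coe_snd_one]
  rfl

/-- **Master formula, `(p, r)`-coordinate** (positive slice, twisted `P`-part):
`z′_{(p,r)} = conj (Σ_{p′} g_{p p′} conj z_{(p′,r)} + Σ_{q′} g_{p q′} z_{(q′,r)})`. [cite: MoeglinVignerasWaldspurger1987, Ch. 1 I.17; KonnoKonno2007, §3.1 (3.1)] -/
theorem phasePt_ιV_inl_inl (g : UForm P Q) (w : PV (DPIdx P Q R S)) (p : P) (r : R) :
    phasePt ((ι𝕎 P Q R S (g, 1)).1 w).1 ((ι𝕎 P Q R S (g, 1)).1 w).2 (Sum.inl (Sum.inl (p, r))) =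
      star (∑ p', ((g : GL (P ⊕ Q) ℂ) : Matrix (P ⊕ Q) (P ⊕ Q) ℂ) (Sum.inl p) (Sum.inl p') *
          star (phasePt w.1 w.2 (Sum.inl (Sum.inl (p', r)))) +
        ∑ q', ((g : GL (P ⊕ Q) ℂ) : Matrix (P ⊕ Q) (P ⊕ Q) ℂ) (Sum.inl p) (Sum.inr q') *
          phasePt w.1 w.2 (Sum.inr (Sum.inr (q', r)))) := by
  rw [phasePt_ιV, tw_inl, reindex_kronecker_one_mulVec]
  simp only [dpEquiv_symm_inl_inl, dpEquiv_inl_inl, dpEquiv_inr_inl, tw_inl, tw_inr]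

/-- **Master formula, `(q, r)`-coordinate** (positive slice, untwisted `Q`-part):
`z′_{(q,r)} = Σ_{p′} g_{q p′} conj z_{(p′,r)} + Σ_{q′} g_{q q′} z_{(q′,r)}`. [cite: MoeglinVignerasWaldspurger1987, Ch. 1 I.17; KonnoKonno2007, §3.1 (3.1)] -/
theorem phasePt_ιV_inr_inr (g : UForm P Q) (w : PV (DPIdx P Q R S)) (q : Q) (r : R) :
    phasePt ((ι𝕎 P Q R S (g, 1)).1 w).1 ((ι𝕎 P Q R S (g, 1)).1 w).2 (Sum.inr (Sum.inr (q, r))) =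
      ∑ p', ((g : GL (P ⊕ Q) ℂ) : Matrix (P ⊕ Q) (P ⊕ Q) ℂ) (Sum.inr q) (Sum.inl p') *
          star (phasePt w.1 w.2 (Sum.inl (Sum.inl (p', r)))) +
        ∑ q', ((g : GL (P ⊕ Q) ℂ) : Matrix (P ⊕ Q) (P ⊕ Q) ℂ) (Sum.inr q) (Sum.inr q') *
          phasePt w.1 w.2 (Sum.inr (Sum.inr (q', r))) := by
  rw [phasePt_ιV, tw_inr, reindex_kronecker_one_mulVec]
  simp only [dpEquiv_symm_inr_inr, dpEquiv_inl_inl, dpEquiv_inr_inl, tw_inl, tw_inr]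

/-- **Master formula, `(p, s)`-coordinate** (negative slice, untwisted `P`-part):
`z′_{(p,s)} = Σ_{p′} g_{p p′} z_{(p′,s)} + Σ_{q′} g_{p q′} conj z_{(q′,s)}`. [cite: MoeglinVignerasWaldspurger1987, Ch. 1 I.17; KonnoKonno2007, §3.1 (3.1)] -/
theorem phasePt_ιV_inr_inl (g : UForm P Q) (w : PV (DPIdx P Q R S)) (p : P) (s : S) :
    phasePt ((ι𝕎 P Q R S (g, 1)).1 w).1 ((ι𝕎 P Q R S (g, 1)).1 w).2 (Sum.inr (Sum.inl (p, s))) =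
      ∑ p', ((g : GL (P ⊕ Q) ℂ) : Matrix (P ⊕ Q) (P ⊕ Q) ℂ) (Sum.inl p) (Sum.inl p') *
          phasePt w.1 w.2 (Sum.inr (Sum.inl (p', s))) +
        ∑ q', ((g : GL (P ⊕ Q) ℂ) : Matrix (P ⊕ Q) (P ⊕ Q) ℂ) (Sum.inl p) (Sum.inr q') *
          star (phasePt w.1 w.2 (Sum.inl (Sum.inr (q', s)))) := by
  rw [phasePt_ιV, tw_inr, reindex_kronecker_one_mulVec]
  simp only [dpEquiv_symm_inr_inl, dpEquiv_inl_inr, dpEquiv_inr_inr, tw_inl, tw_inr]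

/-- **Master formula, `(q, s)`-coordinate** (negative slice, twisted `Q`-part):
`z′_{(q,s)} = conj (Σ_{p′} g_{q p′} z_{(p′,s)} + Σ_{q′} g_{q q′} conj z_{(q′,s)})`. [cite: MoeglinVignerasWaldspurger1987, Ch. 1 I.17; KonnoKonno2007, §3.1 (3.1)] -/
theorem phasePt_ιV_inl_inr (g : UForm P Q) (w : PV (DPIdx P Q R S)) (q : Q) (s : S) :
    phasePt ((ι𝕎 P Q R S (g, 1)).1 w).1 ((ι𝕎 P Q R S (g, 1)).1 w).2 (Sum.inl (Sum.inr (q, s))) =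
      star (∑ p', ((g : GL (P ⊕ Q) ℂ) : Matrix (P ⊕ Q) (P ⊕ Q) ℂ) (Sum.inr q) (Sum.inl p') *
          phasePt w.1 w.2 (Sum.inr (Sum.inl (p', s))) +
        ∑ q', ((g : GL (P ⊕ Q) ℂ) : Matrix (P ⊕ Q) (P ⊕ Q) ℂ) (Sum.inr q) (Sum.inr q') *
          star (phasePt w.1 w.2 (Sum.inl (Sum.inr (q', s))))) := by
  rw [phasePt_ιV, tw_inl, reindex_kronecker_one_mulVec]
  simp only [dpEquiv_symm_inl_inr, dpEquiv_inl_inr, dpEquiv_inr_inr, tw_inl, tw_inr]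

end Master

/-! ## 3. Relabelling `R ≃ R′`, `S ≃ S′` (the `V`-side case of `RealUnitaryDualPairRelabel.ι𝕎_relabel`) -/

section Relabel

variable {R' S' : Type*} [Fintype R'] [DecidableEq R'] [Fintype S'] [DecidableEq S']

omit [Fintype R] [DecidableEq R] [Fintype S] [DecidableEq S] in
/-- relabelling `U(P,Q)` along the identity bijections is the identity. [cite: KonnoKonno2007, §3.1] -/
@[simp] theorem UForm.relabel_refl (g : UForm P Q) :
    UForm.relabel P Q P Q (Equiv.refl P) (Equiv.refl Q) g = g := by
  apply Subtype.ext
  apply Units.ext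
  rw [UForm.coe_relabel, Equiv.sumCongr_refl]
  rfl

/-- **Relabelling the frames of `W` relabels `ι_V`**: along `eR : R ≃ R′`, `eS : S ≃ S′`,
`ι_V^{R′,S′} g = reindexSp (dpIdxCongr 1 1 eR eS)⁻¹ (ι_V^{R,S} g)` — the `V`-side special case (`g ↦ (g, 1)`,
`relabel 1 = 1`) of `ι𝕎_relabel`. [cite: KonnoKonno2007, §3.1 (3.1); MoeglinVignerasWaldspurger1987, Ch. 1 I.17] -/
theorem ιV_relabel (eR : R ≃ R') (eS : S ≃ S') (g : UForm P Q) :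
    ι𝕎 P Q R' S' (g, 1) =
      reindexSp (dpIdxCongr P Q R S P Q R' S' (Equiv.refl P) (Equiv.refl Q) eR eS).symm (ι𝕎 P Q R S (g, 1)) := by
  have h := ι𝕎_relabel (Equiv.refl P) (Equiv.refl Q) eR eS ((g, 1) : Ginf P Q R S)
  rwa [Ginf.relabel_apply, map_one, UForm.relabel_refl] at h

/-- … equivalently `reindexSp (dpIdxCongr 1 1 eR eS) (ι_V^{R′,S′} g) = ι_V^{R,S} g`. [cite: KonnoKonno2007, §3.1 (3.1)] -/
theorem reindexSp_dpIdxCongr_ιV (eR : R ≃ R') (eS : S ≃ S') (g : UForm P Q) :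
    reindexSp (dpIdxCongr P Q R S P Q R' S' (Equiv.refl P) (Equiv.refl Q) eR eS) (ι𝕎 P Q R' S' (g, 1)) =
      ι𝕎 P Q R S (g, 1) := by
  rw [ιV_relabel eR eS g, reindexSp_reindexSp_symm]

end Relabel

/-! ## 4. Additivity in `W`: `ι_V` over `W₁ ⊕ W₂` is the block sum -/

section Additive

variable {R₁ S₁ R₂ S₂ : Type*} [Fintype R₁] [DecidableEq R₁] [Fintype S₁] [DecidableEq S₁] [Fintype R₂]
  [DecidableEq R₂] [Fintype S₂] [DecidableEq S₂]

variable (P Q R₁ S₁ R₂ S₂) in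
/-- **The index bijection of an orthogonal splitting `W = W₁ ⊕ W₂`**:
`DPIdx P Q R₁ S₁ ⊕ DPIdx P Q R₂ S₂ ≃ DPIdx P Q (R₁ ⊕ R₂) (S₁ ⊕ S₂)`, block by block. [folklore] -/
def dpIdxSumEquiv : DPIdx P Q R₁ S₁ ⊕ DPIdx P Q R₂ S₂ ≃ DPIdx P Q (R₁ ⊕ R₂) (S₁ ⊕ S₂) where
  toFun
    | Sum.inl (Sum.inl (Sum.inl (p, r))) => Sum.inl (Sum.inl (p, Sum.inl r))
    | Sum.inl (Sum.inl (Sum.inr (q, s))) => Sum.inl (Sum.inr (q, Sum.inl s))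
    | Sum.inl (Sum.inr (Sum.inl (p, s))) => Sum.inr (Sum.inl (p, Sum.inl s))
    | Sum.inl (Sum.inr (Sum.inr (q, r))) => Sum.inr (Sum.inr (q, Sum.inl r))
    | Sum.inr (Sum.inl (Sum.inl (p, r))) => Sum.inl (Sum.inl (p, Sum.inr r))
    | Sum.inr (Sum.inl (Sum.inr (q, s))) => Sum.inl (Sum.inr (q, Sum.inr s))
    | Sum.inr (Sum.inr (Sum.inl (p, s))) => Sum.inr (Sum.inl (p, Sum.inr s))
    | Sum.inr (Sum.inr (Sum.inr (q, r))) => Sum.inr (Sum.inr (q, Sum.inr r))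
  invFun
    | Sum.inl (Sum.inl (p, Sum.inl r)) => Sum.inl (Sum.inl (Sum.inl (p, r)))
    | Sum.inl (Sum.inl (p, Sum.inr r)) => Sum.inr (Sum.inl (Sum.inl (p, r)))
    | Sum.inl (Sum.inr (q, Sum.inl s)) => Sum.inl (Sum.inl (Sum.inr (q, s)))
    | Sum.inl (Sum.inr (q, Sum.inr s)) => Sum.inr (Sum.inl (Sum.inr (q, s)))
    | Sum.inr (Sum.inl (p, Sum.inl s)) => Sum.inl (Sum.inr (Sum.inl (p, s)))
    | Sum.inr (Sum.inl (p, Sum.inr s)) => Sum.inr (Sum.inr (Sum.inl (p, s)))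
    | Sum.inr (Sum.inr (q, Sum.inl r)) => Sum.inl (Sum.inr (Sum.inr (q, r)))
    | Sum.inr (Sum.inr (q, Sum.inr r)) => Sum.inr (Sum.inr (Sum.inr (q, r)))
  left_inv := by
    rintro (((⟨p, r⟩ | ⟨q, s⟩) | (⟨p, s⟩ | ⟨q, r⟩)) | ((⟨p, r⟩ | ⟨q, s⟩) | (⟨p, s⟩ | ⟨q, r⟩))) <;> rfl
  right_inv := by
    rintro ((⟨p, r | r⟩ | ⟨q, s | s⟩) | (⟨p, s | s⟩ | ⟨q, r | r⟩)) <;> rfl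

omit [Fintype P] [DecidableEq P] [Fintype Q] [DecidableEq Q] [Fintype R₁] [DecidableEq R₁] [Fintype S₁]
  [DecidableEq S₁] [Fintype R₂] [DecidableEq R₂] [Fintype S₂] [DecidableEq S₂] in
/-- `dpIdxSumEquiv`, first summand, `P × R₁`. [folklore] -/
@[simp] private theorem dpIdxSumEquiv_inl_inl_inl (p : P) (r : R₁) :
    dpIdxSumEquiv P Q R₁ S₁ R₂ S₂ (Sum.inl (Sum.inl (Sum.inl (p, r)))) = Sum.inl (Sum.inl (p, Sum.inl r)) := rfl

omit [Fintype P] [DecidableEq P] [Fintype Q] [DecidableEq Q] [Fintype R₁] [DecidableEq R₁] [Fintype S₁]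
  [DecidableEq S₁] [Fintype R₂] [DecidableEq R₂] [Fintype S₂] [DecidableEq S₂] in
/-- `dpIdxSumEquiv`, first summand, `Q × S₁`. [folklore] -/
@[simp] private theorem dpIdxSumEquiv_inl_inl_inr (q : Q) (s : S₁) :
    dpIdxSumEquiv P Q R₁ S₁ R₂ S₂ (Sum.inl (Sum.inl (Sum.inr (q, s)))) = Sum.inl (Sum.inr (q, Sum.inl s)) := rfl

omit [Fintype P] [DecidableEq P] [Fintype Q] [DecidableEq Q] [Fintype R₁] [DecidableEq R₁] [Fintype S₁]
  [DecidableEq S₁] [Fintype R₂] [DecidableEq R₂] [Fintype S₂] [DecidableEq S₂] in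
/-- `dpIdxSumEquiv`, first summand, `P × S₁`. [folklore] -/
@[simp] private theorem dpIdxSumEquiv_inl_inr_inl (p : P) (s : S₁) :
    dpIdxSumEquiv P Q R₁ S₁ R₂ S₂ (Sum.inl (Sum.inr (Sum.inl (p, s)))) = Sum.inr (Sum.inl (p, Sum.inl s)) := rfl

omit [Fintype P] [DecidableEq P] [Fintype Q] [DecidableEq Q] [Fintype R₁] [DecidableEq R₁] [Fintype S₁]
  [DecidableEq S₁] [Fintype R₂] [DecidableEq R₂] [Fintype S₂] [DecidableEq S₂] in
/-- `dpIdxSumEquiv`, first summand, `Q × R₁`. [folklore] -/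
@[simp] private theorem dpIdxSumEquiv_inl_inr_inr (q : Q) (r : R₁) :
    dpIdxSumEquiv P Q R₁ S₁ R₂ S₂ (Sum.inl (Sum.inr (Sum.inr (q, r)))) = Sum.inr (Sum.inr (q, Sum.inl r)) := rfl

omit [Fintype P] [DecidableEq P] [Fintype Q] [DecidableEq Q] [Fintype R₁] [DecidableEq R₁] [Fintype S₁]
  [DecidableEq S₁] [Fintype R₂] [DecidableEq R₂] [Fintype S₂] [DecidableEq S₂] in
/-- `dpIdxSumEquiv`, second summand, `P × R₂`. [folklore] -/
@[simp] private theorem dpIdxSumEquiv_inr_inl_inl (p : P) (r : R₂) :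
    dpIdxSumEquiv P Q R₁ S₁ R₂ S₂ (Sum.inr (Sum.inl (Sum.inl (p, r)))) = Sum.inl (Sum.inl (p, Sum.inr r)) := rfl

omit [Fintype P] [DecidableEq P] [Fintype Q] [DecidableEq Q] [Fintype R₁] [DecidableEq R₁] [Fintype S₁]
  [DecidableEq S₁] [Fintype R₂] [DecidableEq R₂] [Fintype S₂] [DecidableEq S₂] in
/-- `dpIdxSumEquiv`, second summand, `Q × S₂`. [folklore] -/
@[simp] private theorem dpIdxSumEquiv_inr_inl_inr (q : Q) (s : S₂) :
    dpIdxSumEquiv P Q R₁ S₁ R₂ S₂ (Sum.inr (Sum.inl (Sum.inr (q, s)))) = Sum.inl (Sum.inr (q, Sum.inr s)) := rfl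

omit [Fintype P] [DecidableEq P] [Fintype Q] [DecidableEq Q] [Fintype R₁] [DecidableEq R₁] [Fintype S₁]
  [DecidableEq S₁] [Fintype R₂] [DecidableEq R₂] [Fintype S₂] [DecidableEq S₂] in
/-- `dpIdxSumEquiv`, second summand, `P × S₂`. [folklore] -/
@[simp] private theorem dpIdxSumEquiv_inr_inr_inl (p : P) (s : S₂) :
    dpIdxSumEquiv P Q R₁ S₁ R₂ S₂ (Sum.inr (Sum.inr (Sum.inl (p, s)))) = Sum.inr (Sum.inl (p, Sum.inr s)) := rfl

omit [Fintype P] [DecidableEq P] [Fintype Q] [DecidableEq Q] [Fintype R₁] [DecidableEq R₁] [Fintype S₁]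
  [DecidableEq S₁] [Fintype R₂] [DecidableEq R₂] [Fintype S₂] [DecidableEq S₂] in
/-- `dpIdxSumEquiv`, second summand, `Q × R₂`. [folklore] -/
@[simp] private theorem dpIdxSumEquiv_inr_inr_inr (q : Q) (r : R₂) :
    dpIdxSumEquiv P Q R₁ S₁ R₂ S₂ (Sum.inr (Sum.inr (Sum.inr (q, r)))) = Sum.inr (Sum.inr (q, Sum.inr r)) := rfl

omit [Fintype P] [DecidableEq P] [Fintype Q] [DecidableEq Q] [Fintype R₁] [DecidableEq R₁] [Fintype S₁]
  [DecidableEq S₁] [Fintype R₂] [DecidableEq R₂] [Fintype S₂] [DecidableEq S₂] in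
/-- `dpIdxSumEquiv⁻¹` on `P × R₁`. [folklore] -/
@[simp] private theorem dpIdxSumEquiv_symm_inl_inl_inl (p : P) (r : R₁) :
    (dpIdxSumEquiv P Q R₁ S₁ R₂ S₂).symm (Sum.inl (Sum.inl (p, Sum.inl r))) = Sum.inl (Sum.inl (Sum.inl (p, r))) := rfl

omit [Fintype P] [DecidableEq P] [Fintype Q] [DecidableEq Q] [Fintype R₁] [DecidableEq R₁] [Fintype S₁]
  [DecidableEq S₁] [Fintype R₂] [DecidableEq R₂] [Fintype S₂] [DecidableEq S₂] in
/-- `dpIdxSumEquiv⁻¹` on `P × R₂`. [folklore] -/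
@[simp] private theorem dpIdxSumEquiv_symm_inl_inl_inr (p : P) (r : R₂) :
    (dpIdxSumEquiv P Q R₁ S₁ R₂ S₂).symm (Sum.inl (Sum.inl (p, Sum.inr r))) = Sum.inr (Sum.inl (Sum.inl (p, r))) := rfl

omit [Fintype P] [DecidableEq P] [Fintype Q] [DecidableEq Q] [Fintype R₁] [DecidableEq R₁] [Fintype S₁]
  [DecidableEq S₁] [Fintype R₂] [DecidableEq R₂] [Fintype S₂] [DecidableEq S₂] in
/-- `dpIdxSumEquiv⁻¹` on `Q × S₁`. [folklore] -/
@[simp] private theorem dpIdxSumEquiv_symm_inl_inr_inl (q : Q) (s : S₁) :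
    (dpIdxSumEquiv P Q R₁ S₁ R₂ S₂).symm (Sum.inl (Sum.inr (q, Sum.inl s))) = Sum.inl (Sum.inl (Sum.inr (q, s))) := rfl

omit [Fintype P] [DecidableEq P] [Fintype Q] [DecidableEq Q] [Fintype R₁] [DecidableEq R₁] [Fintype S₁]
  [DecidableEq S₁] [Fintype R₂] [DecidableEq R₂] [Fintype S₂] [DecidableEq S₂] in
/-- `dpIdxSumEquiv⁻¹` on `Q × S₂`. [folklore] -/
@[simp] private theorem dpIdxSumEquiv_symm_inl_inr_inr (q : Q) (s : S₂) :
    (dpIdxSumEquiv P Q R₁ S₁ R₂ S₂).symm (Sum.inl (Sum.inr (q, Sum.inr s))) = Sum.inr (Sum.inl (Sum.inr (q, s))) := rfl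

omit [Fintype P] [DecidableEq P] [Fintype Q] [DecidableEq Q] [Fintype R₁] [DecidableEq R₁] [Fintype S₁]
  [DecidableEq S₁] [Fintype R₂] [DecidableEq R₂] [Fintype S₂] [DecidableEq S₂] in
/-- `dpIdxSumEquiv⁻¹` on `P × S₁`. [folklore] -/
@[simp] private theorem dpIdxSumEquiv_symm_inr_inl_inl (p : P) (s : S₁) :
    (dpIdxSumEquiv P Q R₁ S₁ R₂ S₂).symm (Sum.inr (Sum.inl (p, Sum.inl s))) = Sum.inl (Sum.inr (Sum.inl (p, s))) := rfl

omit [Fintype P] [DecidableEq P] [Fintype Q] [DecidableEq Q] [Fintype R₁] [DecidableEq R₁] [Fintype S₁]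
  [DecidableEq S₁] [Fintype R₂] [DecidableEq R₂] [Fintype S₂] [DecidableEq S₂] in
/-- `dpIdxSumEquiv⁻¹` on `P × S₂`. [folklore] -/
@[simp] private theorem dpIdxSumEquiv_symm_inr_inl_inr (p : P) (s : S₂) :
    (dpIdxSumEquiv P Q R₁ S₁ R₂ S₂).symm (Sum.inr (Sum.inl (p, Sum.inr s))) = Sum.inr (Sum.inr (Sum.inl (p, s))) := rfl

omit [Fintype P] [DecidableEq P] [Fintype Q] [DecidableEq Q] [Fintype R₁] [DecidableEq R₁] [Fintype S₁]
  [DecidableEq S₁] [Fintype R₂] [DecidableEq R₂] [Fintype S₂] [DecidableEq S₂] in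
/-- `dpIdxSumEquiv⁻¹` on `Q × R₁`. [folklore] -/
@[simp] private theorem dpIdxSumEquiv_symm_inr_inr_inl (q : Q) (r : R₁) :
    (dpIdxSumEquiv P Q R₁ S₁ R₂ S₂).symm (Sum.inr (Sum.inr (q, Sum.inl r))) = Sum.inl (Sum.inr (Sum.inr (q, r))) := rfl

omit [Fintype P] [DecidableEq P] [Fintype Q] [DecidableEq Q] [Fintype R₁] [DecidableEq R₁] [Fintype S₁]
  [DecidableEq S₁] [Fintype R₂] [DecidableEq R₂] [Fintype S₂] [DecidableEq S₂] in
/-- `dpIdxSumEquiv⁻¹` on `Q × R₂`. [folklore] -/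
@[simp] private theorem dpIdxSumEquiv_symm_inr_inr_inr (q : Q) (r : R₂) :
    (dpIdxSumEquiv P Q R₁ S₁ R₂ S₂).symm (Sum.inr (Sum.inr (q, Sum.inr r))) = Sum.inr (Sum.inr (Sum.inr (q, r))) := rfl

/-- **`ι_V` is additive in `W`**: after the block relabelling, `ι_V^{R₁ ⊕ R₂, S₁ ⊕ S₂} g` is the block sum
`ι_V^{R₁,S₁} g ⊕ ι_V^{R₂,S₂} g`. [cite: MoeglinVignerasWaldspurger1987, Ch. 1 I.17, Ch. 2 II.1 (6); Kudla1994, §1] -/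
theorem reindexSp_dpIdxSumEquiv_ιV (g : UForm P Q) :
    reindexSp (dpIdxSumEquiv P Q R₁ S₁ R₂ S₂) (ι𝕎 P Q (R₁ ⊕ R₂) (S₁ ⊕ S₂) (g, 1)) =
      spBlock (ι𝕎 P Q R₁ S₁ (g, 1), ι𝕎 P Q R₂ S₂ (g, 1)) := by
  apply Subtype.ext
  apply LinearEquiv.ext
  intro w
  apply pv_ext
  funext k
  simp only [coe_reindexSp_apply, reindexPV_apply, reindexPV_symm_apply, phasePt_comp, Function.comp_apply,
    coe_spBlock_apply, blockPhase]
  rcases k with (((⟨p, r⟩ | ⟨q, s⟩) | (⟨p, s⟩ | ⟨q, r⟩)) | ((⟨p, r⟩ | ⟨q, s⟩) | (⟨p, s⟩ | ⟨q, r⟩)))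
  · simp only [dpIdxSumEquiv_inl_inl_inl, phasePt_ιV_inl_inl, phasePt_sumElim_inl, phasePt_comp, Function.comp_apply,
      dpIdxSumEquiv_symm_inl_inl_inl, dpIdxSumEquiv_symm_inr_inr_inl]
  · simp only [dpIdxSumEquiv_inl_inl_inr, phasePt_ιV_inl_inr, phasePt_sumElim_inl, phasePt_comp, Function.comp_apply,
      dpIdxSumEquiv_symm_inr_inl_inl, dpIdxSumEquiv_symm_inl_inr_inl]
  · simp only [dpIdxSumEquiv_inl_inr_inl, phasePt_ιV_inr_inl, phasePt_sumElim_inl, phasePt_comp, Function.comp_apply,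
      dpIdxSumEquiv_symm_inr_inl_inl, dpIdxSumEquiv_symm_inl_inr_inl]
  · simp only [dpIdxSumEquiv_inl_inr_inr, phasePt_ιV_inr_inr, phasePt_sumElim_inl, phasePt_comp, Function.comp_apply,
      dpIdxSumEquiv_symm_inl_inl_inl, dpIdxSumEquiv_symm_inr_inr_inl]
  · simp only [dpIdxSumEquiv_inr_inl_inl, phasePt_ιV_inl_inl, phasePt_sumElim_inr, phasePt_comp, Function.comp_apply,
      dpIdxSumEquiv_symm_inl_inl_inr, dpIdxSumEquiv_symm_inr_inr_inr]
  · simp only [dpIdxSumEquiv_inr_inl_inr, phasePt_ιV_inl_inr, phasePt_sumElim_inr, phasePt_comp, Function.comp_apply,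
      dpIdxSumEquiv_symm_inr_inl_inr, dpIdxSumEquiv_symm_inl_inr_inr]
  · simp only [dpIdxSumEquiv_inr_inr_inl, phasePt_ιV_inr_inl, phasePt_sumElim_inr, phasePt_comp, Function.comp_apply,
      dpIdxSumEquiv_symm_inr_inl_inr, dpIdxSumEquiv_symm_inl_inr_inr]
  · simp only [dpIdxSumEquiv_inr_inr_inr, phasePt_ιV_inr_inr, phasePt_sumElim_inr, phasePt_comp, Function.comp_apply,
      dpIdxSumEquiv_symm_inl_inl_inr, dpIdxSumEquiv_symm_inr_inr_inr]

/-- … equivalently `ι_V^{R₁ ⊕ R₂, S₁ ⊕ S₂} g = reindexSp dpIdxSumEquiv⁻¹ (ι_V^{R₁,S₁} g ⊕ ι_V^{R₂,S₂} g)`.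
[cite: MoeglinVignerasWaldspurger1987, Ch. 2 II.1 (6)] -/
theorem ιV_sum_eq_reindexSp (g : UForm P Q) :
    ι𝕎 P Q (R₁ ⊕ R₂) (S₁ ⊕ S₂) (g, 1) =
      reindexSp (dpIdxSumEquiv P Q R₁ S₁ R₂ S₂).symm (spBlock (ι𝕎 P Q R₁ S₁ (g, 1), ι𝕎 P Q R₂ S₂ (g, 1))) := by
  rw [← reindexSp_dpIdxSumEquiv_ιV g]
  apply Subtype.ext
  apply LinearEquiv.ext
  intro w
  simp only [coe_reindexSp_apply, reindexPV_apply, reindexPV_symm_apply, Equiv.symm_symm, Function.comp_def,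
    Equiv.apply_symm_apply, Prod.mk.eta]

end Additive

/-! ## 5. A hyperbolic pair in `W`: `ι_V` on `V ⊗ ⟨e₊, e₋⟩ ≅ V ⊕ V̄` is the twisted diagonal `X ⊕ cXc` -/

section Pair

variable {T S₀ : Type*} [Fintype T] [DecidableEq T] [Fintype S₀] [DecidableEq S₀] [IsEmpty S₀]

variable (P Q T S₀) in
/-- the positive copy: `DPIdx P Q T S₀ → DPIdx P Q T T` onto the slice over `e₊` (`r`-labels). [folklore] -/
def dpIdxPairPos : DPIdx P Q T S₀ → DPIdx P Q T T
  | Sum.inl (Sum.inl (p, t)) => Sum.inl (Sum.inl (p, t))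
  | Sum.inl (Sum.inr (_, s)) => isEmptyElim s
  | Sum.inr (Sum.inl (_, s)) => isEmptyElim s
  | Sum.inr (Sum.inr (q, t)) => Sum.inr (Sum.inr (q, t))

variable (P Q T S₀) in
/-- the negative copy: `DPIdx P Q T S₀ → DPIdx P Q T T` onto the slice over `e₋` (`s`-labels); NOTE the twisted block
of the source (`P`-labels) goes to the UNtwisted `P × S` block and vice versa — the slice over a negative line carries
the conjugate complex structure. [folklore] -/
def dpIdxPairNeg : DPIdx P Q T S₀ → DPIdx P Q T T
  | Sum.inl (Sum.inl (p, t)) => Sum.inr (Sum.inl (p, t))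
  | Sum.inl (Sum.inr (_, s)) => isEmptyElim s
  | Sum.inr (Sum.inl (_, s)) => isEmptyElim s
  | Sum.inr (Sum.inr (q, t)) => Sum.inl (Sum.inr (q, t))

variable (P Q T S₀) in
/-- backwards: `DPIdx P Q T T → DPIdx P Q T S₀ ⊕ DPIdx P Q T S₀`. [folklore] -/
def dpIdxPairInv : DPIdx P Q T T → DPIdx P Q T S₀ ⊕ DPIdx P Q T S₀
  | Sum.inl (Sum.inl (p, t)) => Sum.inl (Sum.inl (Sum.inl (p, t)))
  | Sum.inl (Sum.inr (q, t)) => Sum.inr (Sum.inr (Sum.inr (q, t)))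
  | Sum.inr (Sum.inl (p, t)) => Sum.inr (Sum.inl (Sum.inl (p, t)))
  | Sum.inr (Sum.inr (q, t)) => Sum.inl (Sum.inr (Sum.inr (q, t)))

variable (P Q T S₀) in
/-- **The index bijection of a hyperbolic pair**: two copies of the positive-line index `DPIdx P Q T S₀` (`S₀` empty)
onto `DPIdx P Q T T` — the first copy onto the `r`-slices, the second onto the `s`-slices with the twist exchanged.
[folklore] -/
def dpIdxPairEquiv : DPIdx P Q T S₀ ⊕ DPIdx P Q T S₀ ≃ DPIdx P Q T T where
  toFun := Sum.elim (dpIdxPairPos P Q T S₀) (dpIdxPairNeg P Q T S₀)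
  invFun := dpIdxPairInv P Q T S₀
  left_inv := by
    rintro (((⟨p, t⟩ | ⟨q, s⟩) | (⟨p, s⟩ | ⟨q, t⟩)) | ((⟨p, t⟩ | ⟨q, s⟩) | (⟨p, s⟩ | ⟨q, t⟩)))
    all_goals first | rfl | exact isEmptyElim s
  right_inv := by
    rintro ((⟨p, t⟩ | ⟨q, t⟩) | (⟨p, t⟩ | ⟨q, t⟩)) <;> rfl

omit [Fintype P] [DecidableEq P] [Fintype Q] [DecidableEq Q] [Fintype T] [DecidableEq T] [Fintype S₀]
  [DecidableEq S₀] in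
/-- `dpIdxPairEquiv`, positive copy, `P`-labels. [folklore] -/
@[simp] private theorem dpIdxPairEquiv_inl_inl_inl (p : P) (t : T) :
    dpIdxPairEquiv P Q T S₀ (Sum.inl (Sum.inl (Sum.inl (p, t)))) = Sum.inl (Sum.inl (p, t)) := rfl

omit [Fintype P] [DecidableEq P] [Fintype Q] [DecidableEq Q] [Fintype T] [DecidableEq T] [Fintype S₀]
  [DecidableEq S₀] in
/-- `dpIdxPairEquiv`, positive copy, `Q`-labels. [folklore] -/
@[simp] private theorem dpIdxPairEquiv_inl_inr_inr (q : Q) (t : T) :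
    dpIdxPairEquiv P Q T S₀ (Sum.inl (Sum.inr (Sum.inr (q, t)))) = Sum.inr (Sum.inr (q, t)) := rfl

omit [Fintype P] [DecidableEq P] [Fintype Q] [DecidableEq Q] [Fintype T] [DecidableEq T] [Fintype S₀]
  [DecidableEq S₀] in
/-- `dpIdxPairEquiv`, negative copy, `P`-labels. [folklore] -/
@[simp] private theorem dpIdxPairEquiv_inr_inl_inl (p : P) (t : T) :
    dpIdxPairEquiv P Q T S₀ (Sum.inr (Sum.inl (Sum.inl (p, t)))) = Sum.inr (Sum.inl (p, t)) := rfl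

omit [Fintype P] [DecidableEq P] [Fintype Q] [DecidableEq Q] [Fintype T] [DecidableEq T] [Fintype S₀]
  [DecidableEq S₀] in
/-- `dpIdxPairEquiv`, negative copy, `Q`-labels. [folklore] -/
@[simp] private theorem dpIdxPairEquiv_inr_inr_inr (q : Q) (t : T) :
    dpIdxPairEquiv P Q T S₀ (Sum.inr (Sum.inr (Sum.inr (q, t)))) = Sum.inl (Sum.inr (q, t)) := rfl

omit [Fintype P] [DecidableEq P] [Fintype Q] [DecidableEq Q] [Fintype T] [DecidableEq T] [Fintype S₀]
  [DecidableEq S₀] in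
/-- `dpIdxPairEquiv⁻¹` on `P × R`. [folklore] -/
@[simp] private theorem dpIdxPairEquiv_symm_inl_inl (p : P) (t : T) :
    (dpIdxPairEquiv P Q T S₀).symm (Sum.inl (Sum.inl (p, t))) = Sum.inl (Sum.inl (Sum.inl (p, t))) := rfl

omit [Fintype P] [DecidableEq P] [Fintype Q] [DecidableEq Q] [Fintype T] [DecidableEq T] [Fintype S₀]
  [DecidableEq S₀] in
/-- `dpIdxPairEquiv⁻¹` on `Q × S`. [folklore] -/
@[simp] private theorem dpIdxPairEquiv_symm_inl_inr (q : Q) (t : T) :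
    (dpIdxPairEquiv P Q T S₀).symm (Sum.inl (Sum.inr (q, t))) = Sum.inr (Sum.inr (Sum.inr (q, t))) := rfl

omit [Fintype P] [DecidableEq P] [Fintype Q] [DecidableEq Q] [Fintype T] [DecidableEq T] [Fintype S₀]
  [DecidableEq S₀] in
/-- `dpIdxPairEquiv⁻¹` on `P × S`. [folklore] -/
@[simp] private theorem dpIdxPairEquiv_symm_inr_inl (p : P) (t : T) :
    (dpIdxPairEquiv P Q T S₀).symm (Sum.inr (Sum.inl (p, t))) = Sum.inr (Sum.inl (Sum.inl (p, t))) := rfl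

omit [Fintype P] [DecidableEq P] [Fintype Q] [DecidableEq Q] [Fintype T] [DecidableEq T] [Fintype S₀]
  [DecidableEq S₀] in
/-- `dpIdxPairEquiv⁻¹` on `Q × R`. [folklore] -/
@[simp] private theorem dpIdxPairEquiv_symm_inr_inr (q : Q) (t : T) :
    (dpIdxPairEquiv P Q T S₀).symm (Sum.inr (Sum.inr (q, t))) = Sum.inl (Sum.inr (Sum.inr (q, t))) := rfl

/-- **`ι_V` on a hyperbolic pair is the twisted diagonal**: after the pair relabelling,
`ι_V^{T,T} g = X ⊕ c X c` with `X = ι_V^{T,S₀} g` the embedding over the positive lines alone — the slice over the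
negative lines carries the conjugate structure `V̄`, and `V ⊗ ⟨e₊, e₋⟩ ≅ V ⊕ V̄` is the doubled space of
`ArchTwistedDiagonalLevi`. [cite: Kudla1994, §1, Prop. 4.1; Paul1998, §1.2 (1.2.1); MoeglinVignerasWaldspurger1987, Ch. 1 I.17] -/
theorem reindexSp_dpIdxPairEquiv_ιV (g : UForm P Q) :
    reindexSp (dpIdxPairEquiv P Q T S₀) (ι𝕎 P Q T T (g, 1)) =
      spBlock (ι𝕎 P Q T S₀ (g, 1), Sp.conjSp (DPIdx P Q T S₀) (ι𝕎 P Q T S₀ (g, 1))) := by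
  apply Subtype.ext
  apply LinearEquiv.ext
  intro w
  apply pv_ext
  funext k
  simp only [coe_reindexSp_apply, reindexPV_apply, reindexPV_symm_apply, phasePt_comp, Function.comp_apply,
    coe_spBlock_apply, blockPhase, Sp.coe_conjSp_apply, Sp.conjW_apply]
  rcases k with (((⟨p, t⟩ | ⟨q, s⟩) | (⟨p, s⟩ | ⟨q, t⟩)) | ((⟨p, t⟩ | ⟨q, s⟩) | (⟨p, s⟩ | ⟨q, t⟩)))
  · simp only [dpIdxPairEquiv_inl_inl_inl, phasePt_ιV_inl_inl, phasePt_sumElim_inl, phasePt_comp, Function.comp_apply,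
      dpIdxPairEquiv_symm_inl_inl, dpIdxPairEquiv_symm_inr_inr]
  · exact isEmptyElim s
  · exact isEmptyElim s
  · simp only [dpIdxPairEquiv_inl_inr_inr, phasePt_ιV_inr_inr, phasePt_sumElim_inl, phasePt_comp, Function.comp_apply,
      dpIdxPairEquiv_symm_inl_inl, dpIdxPairEquiv_symm_inr_inr]
  · simp only [dpIdxPairEquiv_inr_inl_inl, phasePt_ιV_inr_inl, phasePt_sumElim_inr, phasePt_neg_snd, phasePt_ιV_inl_inl,
      phasePt_comp, Function.comp_apply, dpIdxPairEquiv_symm_inr_inl, dpIdxPairEquiv_symm_inl_inr, star_star]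
  · exact isEmptyElim s
  · exact isEmptyElim s
  · simp only [dpIdxPairEquiv_inr_inr_inr, phasePt_ιV_inl_inr, phasePt_sumElim_inr, phasePt_neg_snd, phasePt_ιV_inr_inr,
      phasePt_comp, Function.comp_apply, dpIdxPairEquiv_symm_inr_inl, dpIdxPairEquiv_symm_inl_inr, star_star]

/-- … equivalently `ι_V^{T,T} g = reindexSp dpIdxPairEquiv⁻¹ (X ⊕ cXc)`. [cite: Kudla1994, §1, Prop. 4.1] -/
theorem ιV_pair_eq_reindexSp (g : UForm P Q) :
    ι𝕎 P Q T T (g, 1) = reindexSp (dpIdxPairEquiv P Q T S₀).symm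
      (spBlock (ι𝕎 P Q T S₀ (g, 1), Sp.conjSp (DPIdx P Q T S₀) (ι𝕎 P Q T S₀ (g, 1)))) := by
  rw [← reindexSp_dpIdxPairEquiv_ιV g]
  apply Subtype.ext
  apply LinearEquiv.ext
  intro w
  simp only [coe_reindexSp_apply, reindexPV_apply, reindexPV_symm_apply, Equiv.symm_symm, Function.comp_def,
    Equiv.apply_symm_apply, Prod.mk.eta]

end Pair

/-! ## 6. The degenerate case `W = 0` -/

section Empty

/-- **`ι_V g = 1` when `W = 0`** (`R`, `S` empty: the index type `DPIdx P Q R S` is empty and `Sp(𝕎)` is trivial).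
[cite: MoeglinVignerasWaldspurger1987, Ch. 1 I.17] -/
theorem ιV_eq_one_of_isEmpty [IsEmpty R] [IsEmpty S] (g : UForm P Q) : ι𝕎 P Q R S (g, 1) = 1 := by
  apply Subtype.ext
  apply LinearEquiv.ext
  intro w
  exact Subsingleton.elim _ _

end Empty

end RealDualPair

end Literature.RepresentationTheory.KonnoKonno2007

end
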